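/- Free-seat work of WIDTH SEAT `ym-line-cbag-p1-w2` (prover-ym-line-cbag-p1-w2-g18-0), route `EguchiKawaiDirectionLadder`
(ideator ym-idea-2, LINE 8), crux `TripleSmallBallMargin` (stmt-QuantumFields-27724), v7 last mile: the FILE-B DOOR.  The
LEAD's main file (FILE A) proves a bound on the Vandermonde-weighted first-link fibre of the `d = 3` small-ball event for
CENTRE-SYMMETRIC eigenangle configurations, for `N ≥ N₀` and `0 < t ≤ t₀`; this file turns any such statement into
`EKSymSmallBallBound 3 δ e C'` and, when `e > 3/4`, into the crux BY NAME.  Pure glue (Weyl + first-link Fubini are the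
already-landed `ekHaar_symSmallBall_le_of_eigenangle_bound`; `t > t₀` is the trivial branch «probability ≤ 1»).  The route
bears on the barrier-ledger fact `EguchiKawaiBreakdown`; the Yang–Mills mass gap is NOT proved by anything here. -/
import Summits.QuantumFields.YangMills.Theses.EguchiKawaiDirectionLadder
import Summits.QuantumFields.YangMills.Theorems.EguchiKawaiDirectionLadderSymFibreDecoupled
import Summits.QuantumFields.YangMills.Theorems.EguchiKawaiDirectionLadderTripleFibre
import Summits.QuantumFields.YangMills.Theorems.EguchiKawaiDirectionLadderFirstLinkWeylReduction
import HarnessLib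

/-!
# Route `EguchiKawaiDirectionLadder`, crux `TripleSmallBallMargin`: the door from a centre-symmetric fibre bound

Write `D_θ = diag(e^{iθ}) ∈ U(N)`, `V(θ) = ∏_{j<k} |e^{iθ_j} − e^{iθ_k}|²` and
`E_{D}(t) = tripleFibreEvent D t = {(X,Y) ∈ U(N)² | S_R(![D,X,Y]) ≤ t}`.

* `ekSymSmallBallBound_three_of_symFibreBound_trace` — if for all `N ≥ N₀`, `0 < t ≤ t₀` and all `θ` with
  `‖tr D_θ / N‖² ≤ δ` one has `V(θ) · (Haar ⊗ Haar)(E_{D_θ}(t)) ≤ exp(N²(e log t + C))` (with `0 ≤ e`, `0 < t₀`), then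
  `EKSymSmallBallBound 3 δ e (max C (−e log t₀))`.  Proof: for `t ≤ t₀`, `ekHaar_symSmallBall_le_of_eigenangle_bound`
  (links `2 + 1 = 3`) after identifying the first-link fibre `ekHaar 2 N {W | S_R(D :: W) ≤ t}` with
  `(Haar ⊗ Haar)(E_D(t))` (`TripleFibre.ekHaar_two_consFibre_eq_prod`); for `t > t₀` the measure is `≤ 1 ≤ exp(…)`.
* `ekSymSmallBallBound_three_of_symFibreBound` — the same with the guard written `‖(Σ_j e^{iθ_j}) / N‖² ≤ δ`
  (`trace_diagPhases`).
* `tripleSmallBallMargin_of_symFibreBound_trace`, `tripleSmallBallMargin_of_symFibreBound` — with `0 < δ` and `3/4 < e`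
  the crux `Theses.EguchiKawaiDirectionLadder.TripleSmallBallMargin` follows BY NAME.
-/

set_option autoImplicit false

noncomputable section

open MeasureTheory
open scoped ENNReal
open Literature.Barriers.QuantumFields
open Literature.LinearAlgebra.Matrix (diagonalTorusHom)
open Literature.MathematicalPhysics.QuantumFieldTheory (haarProbability)

namespace Summit.QuantumFields.YangMills.Theorems.EguchiKawaiDirectionLadder

/-- **Fibre bound ⇒ small-ball bound (trace-form guard).**  If for all `N ≥ N₀`, all `0 < t ≤ t₀` and all eigenangle
configurations `θ` with `‖tr diag(e^{iθ}) / N‖² ≤ δ` the Vandermonde-weighted pair-Haar measure of the triple fibre event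
over `diag(e^{iθ})` is at most `exp(N²(e·log t + C))`, with `0 ≤ e` and `0 < t₀`, then `EKSymSmallBallBound 3 δ e C'` holds
with `C' = max C (−e·log t₀)` (and the same `N₀`). -/
theorem ekSymSmallBallBound_three_of_symFibreBound_trace {δ e C t₀ : ℝ} {N₀ : ℕ} (he : 0 ≤ e) (ht₀ : 0 < t₀)
    (h : ∀ N : ℕ, N₀ ≤ N → ∀ t : ℝ, 0 < t → t ≤ t₀ → ∀ θ : Fin N → ℝ,
      ‖Matrix.trace ((diagonalTorusHom (Fin N) fun j => Circle.exp (θ j) : UN N) : Matrix (Fin N) (Fin N) ℂ) /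
          (N : ℂ)‖ ^ 2 ≤ δ →
      ENNReal.ofReal (∏ j : Fin N, ∏ k ∈ Finset.Ioi j,
          ‖Complex.exp (θ j * Complex.I) - Complex.exp (θ k * Complex.I)‖ ^ 2) *
        ((haarProbability (UN N)).prod (haarProbability (UN N)))
          (tripleFibreEvent (diagonalTorusHom (Fin N) fun j => Circle.exp (θ j)) t) ≤
        ENNReal.ofReal (Real.exp ((N : ℝ) ^ 2 * (e * Real.log t + C)))) :
    EKSymSmallBallBound 3 δ e (max C (-(e * Real.log t₀))) := by
  refine ⟨N₀, fun N hN t ht => ?_⟩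
  by_cases ht1 : t ≤ t₀
  · -- `0 < t ≤ t₀`: Weyl + first-link Fubini, then the fibre bound
    refine ekHaar_symSmallBall_le_of_eigenangle_bound 2 N δ t _ fun θ hθ => ?_
    have hset : ekHaar 2 N {W : EKConfig 2 N |
        ekAction (Fin.cons (diagonalTorusHom (Fin N) fun j => Circle.exp (θ j)) W : EKConfig (2 + 1) N) ≤ t} =
        ((haarProbability (UN N)).prod (haarProbability (UN N)))
          (tripleFibreEvent (diagonalTorusHom (Fin N) fun j => Circle.exp (θ j)) t) :=
      TripleFibre.ekHaar_two_consFibre_eq_prod _ t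
    rw [hset]
    refine (h N hN t ht ht1 θ hθ).trans (ENNReal.ofReal_le_ofReal (Real.exp_le_exp.mpr ?_))
    have hC : C ≤ max C (-(e * Real.log t₀)) := le_max_left _ _
    nlinarith [sq_nonneg (N : ℝ)]
  · -- `t > t₀`: probability `≤ 1 ≤ exp(N²(e log t + C'))`
    have ht1' : t₀ < t := lt_of_not_ge ht1
    have hlog : Real.log t₀ ≤ Real.log t := Real.log_le_log ht₀ ht1'.le
    have hC' : -(e * Real.log t₀) ≤ max C (-(e * Real.log t₀)) := le_max_right _ _
    have hin : 0 ≤ e * Real.log t + max C (-(e * Real.log t₀)) := by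
      nlinarith [mul_le_mul_of_nonneg_left hlog he]
    have hx : 0 ≤ (N : ℝ) ^ 2 * (e * Real.log t + max C (-(e * Real.log t₀))) := by positivity
    calc ekHaar 3 N (ekSymRegion 3 N δ ∩ {U | ekAction U ≤ t}) ≤ 1 := prob_le_one
      _ = ENNReal.ofReal 1 := ENNReal.ofReal_one.symm
      _ ≤ ENNReal.ofReal (Real.exp ((N : ℝ) ^ 2 * (e * Real.log t + max C (-(e * Real.log t₀))))) :=
          ENNReal.ofReal_le_ofReal (Real.one_le_exp hx)

/-- **Fibre bound ⇒ small-ball bound (sum-form guard).**  As `ekSymSmallBallBound_three_of_symFibreBound_trace`, with the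
centre-symmetry guard written `‖(Σ_j e^{iθ_j}) / N‖² ≤ δ`. -/
theorem ekSymSmallBallBound_three_of_symFibreBound {δ e C t₀ : ℝ} {N₀ : ℕ} (he : 0 ≤ e) (ht₀ : 0 < t₀)
    (h : ∀ N : ℕ, N₀ ≤ N → ∀ t : ℝ, 0 < t → t ≤ t₀ → ∀ θ : Fin N → ℝ,
      ‖(∑ j : Fin N, Complex.exp (θ j * Complex.I)) / (N : ℂ)‖ ^ 2 ≤ δ →
      ENNReal.ofReal (∏ j : Fin N, ∏ k ∈ Finset.Ioi j,
          ‖Complex.exp (θ j * Complex.I) - Complex.exp (θ k * Complex.I)‖ ^ 2) *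
        ((haarProbability (UN N)).prod (haarProbability (UN N)))
          (tripleFibreEvent (diagonalTorusHom (Fin N) fun j => Circle.exp (θ j)) t) ≤
        ENNReal.ofReal (Real.exp ((N : ℝ) ^ 2 * (e * Real.log t + C)))) :
    EKSymSmallBallBound 3 δ e (max C (-(e * Real.log t₀))) :=
  ekSymSmallBallBound_three_of_symFibreBound_trace he ht₀ fun N hN t ht ht1 θ hθ =>
    h N hN t ht ht1 θ (by rwa [trace_diagPhases] at hθ)

/-- **The FILE-B door (trace-form guard)**: a centre-symmetric fibre bound with exponent `e > 3/4` at some width `δ > 0`,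
for `N ≥ N₀` and `0 < t ≤ t₀`, proves the crux `TripleSmallBallMargin` BY NAME. -/
theorem tripleSmallBallMargin_of_symFibreBound_trace {δ e C t₀ : ℝ} {N₀ : ℕ} (hδ : 0 < δ) (he : (3 : ℝ) / 4 < e)
    (ht₀ : 0 < t₀)
    (h : ∀ N : ℕ, N₀ ≤ N → ∀ t : ℝ, 0 < t → t ≤ t₀ → ∀ θ : Fin N → ℝ,
      ‖Matrix.trace ((diagonalTorusHom (Fin N) fun j => Circle.exp (θ j) : UN N) : Matrix (Fin N) (Fin N) ℂ) /
          (N : ℂ)‖ ^ 2 ≤ δ →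
      ENNReal.ofReal (∏ j : Fin N, ∏ k ∈ Finset.Ioi j,
          ‖Complex.exp (θ j * Complex.I) - Complex.exp (θ k * Complex.I)‖ ^ 2) *
        ((haarProbability (UN N)).prod (haarProbability (UN N)))
          (tripleFibreEvent (diagonalTorusHom (Fin N) fun j => Circle.exp (θ j)) t) ≤
        ENNReal.ofReal (Real.exp ((N : ℝ) ^ 2 * (e * Real.log t + C)))) :
    Summit.QuantumFields.YangMills.Theses.EguchiKawaiDirectionLadder.TripleSmallBallMargin := by
  unfold Summit.QuantumFields.YangMills.Theses.EguchiKawaiDirectionLadder.TripleSmallBallMargin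
  exact ⟨δ, e, _, hδ, he, ekSymSmallBallBound_three_of_symFibreBound_trace (by linarith) ht₀ h⟩

/-- **The FILE-B door (sum-form guard)**: a centre-symmetric fibre bound — for all `N ≥ N₀`, `0 < t ≤ t₀` and all `θ` with
`‖(Σ_j e^{iθ_j}) / N‖² ≤ δ`, `∏_{j<k}|e^{iθ_j} − e^{iθ_k}|² · (Haar ⊗ Haar)(tripleFibreEvent diag(e^{iθ}) t) ≤ exp(N²(e log t + C))`
— with `0 < δ`, `3/4 < e`, `0 < t₀` proves the crux `TripleSmallBallMargin` BY NAME. -/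
theorem tripleSmallBallMargin_of_symFibreBound {δ e C t₀ : ℝ} {N₀ : ℕ} (hδ : 0 < δ) (he : (3 : ℝ) / 4 < e)
    (ht₀ : 0 < t₀)
    (h : ∀ N : ℕ, N₀ ≤ N → ∀ t : ℝ, 0 < t → t ≤ t₀ → ∀ θ : Fin N → ℝ,
      ‖(∑ j : Fin N, Complex.exp (θ j * Complex.I)) / (N : ℂ)‖ ^ 2 ≤ δ →
      ENNReal.ofReal (∏ j : Fin N, ∏ k ∈ Finset.Ioi j,
          ‖Complex.exp (θ j * Complex.I) - Complex.exp (θ k * Complex.I)‖ ^ 2) *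
        ((haarProbability (UN N)).prod (haarProbability (UN N)))
          (tripleFibreEvent (diagonalTorusHom (Fin N) fun j => Circle.exp (θ j)) t) ≤
        ENNReal.ofReal (Real.exp ((N : ℝ) ^ 2 * (e * Real.log t + C)))) :
    Summit.QuantumFields.YangMills.Theses.EguchiKawaiDirectionLadder.TripleSmallBallMargin := by
  unfold Summit.QuantumFields.YangMills.Theses.EguchiKawaiDirectionLadder.TripleSmallBallMargin
  exact ⟨δ, e, _, hδ, he, ekSymSmallBallBound_three_of_symFibreBound (by linarith) ht₀ h⟩

end Summit.QuantumFields.YangMills.Theorems.EguchiKawaiDirectionLadder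

end
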